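/-
# Lattice sampling of Suzuki's screw function under «finitely many zeros off the line» — part C (§§4–5)

(rh-split cell, seat rh-split-screw-bridge g11, 2026-08-27.)  Part C of the three-part carve of
`HOME/rh-split-screw-bridge/g11/ScrewLatticeFoz.lean` (sha16 eab9b912b5bab0ac): §§4–5 = kernel
ll. 442–797 byte-identical, namespace re-opened (FQNs unchanged).  Nothing in this file is a claim
about the truth of RH.
-/
import Summits.RiemannHypothesis.RiemannHypothesis.Theorems.Splittings.ScrewLatticeFozB
import HarnessLib

/-!
# Part C — the main theorem and the splitting

`strip_of_cofiniteStrip_of_latticeFloor` (lattice sampling under a cofinite strip hypothesis), the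
graded lattice dictionary `quasiRH_iff_cofiniteStrip_and_latticeFloor`, and the splitting
`foz_and_latticePos_iff_rh : (CofiniteCriticalLine ∧ ∀ k, 0 ≤ Ψ(k h)) ↔ RiemannHypothesis` (every `h > 0`).
-/

set_option linter.dupNamespace false

noncomputable section

open Complex Filter Topology Finset
open scoped ComplexConjugate

namespace Summit.RiemannHypothesis.RiemannHypothesis.Theorems.Splittings.ScrewLatticeFoz

open Literature.NumberTheory.LFunctions
open ZetaZeros.riemannZetaNontrivialZeros

/-! ## 4. The main theorem: lattice sampling under a cofinite strip hypothesis -/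

/-- **Lattice sampling under a cofinite strip hypothesis.**  Let `h > 0`, `η ≥ 0`, `B' ∈ ℝ`.
If only finitely many non-trivial zeros have `|Re ρ - 1/2| > B'`, and the screw function has the
graded floor `Ψ(k h) ≥ -K e^{η k h}` along the lattice `k ∈ ℕ`, then every non-trivial zero has
`|Re ρ - 1/2| ≤ max B' η`.  (Top layer `|σ| = B > max(B', η, 0)` finite and non-empty ⇒ the
finite unimodular sum `Σ_T Re(c_ρ u_ρ^k)`, `u_ρ = e^{iλ_ρ h}`, is `≥ -E_k → 0`, contradicting the
Bohr-mean lemma since every `Re c_ρ < 0`.) -/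
theorem strip_of_cofiniteStrip_of_latticeFloor {h η B' : ℝ} (hh : 0 < h) (hη : 0 ≤ η)
    (hfin : {ρ : ℂ | ρ ∈ ZetaZeros.riemannZetaNontrivialZeros ∧ B' < |ρ.re - 1 / 2|}.Finite)
    (hfloor : ∃ K : ℝ, ∀ k : ℕ, -K * Real.exp (η * (k * h)) ≤ zetaScrew (k * h)) :
    ∀ ρ : ℂ, ρ ∈ ZetaZeros.riemannZetaNontrivialZeros → |ρ.re - 1 / 2| ≤ max B' η := by
  classical
  by_contra hcon
  push Not at hcon
  obtain ⟨ρ₁, hρ₁, hρ₁'⟩ := hcon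
  obtain ⟨K, hK⟩ := hfloor
  -- the finite set `Of` of zeros beyond `B'`
  set O : Set ZetaZeros.riemannZetaNontrivialZeros := {ρ | B' < |(ρ : ℂ).re - 1 / 2|} with hO
  have hOfin : O.Finite := by
    have h1 : (Subtype.val ⁻¹'
        {ρ : ℂ | ρ ∈ ZetaZeros.riemannZetaNontrivialZeros ∧ B' < |ρ.re - 1 / 2|} :
          Set ZetaZeros.riemannZetaNontrivialZeros).Finite :=
      hfin.preimage Subtype.val_injective.injOn
    exact h1.subset fun ρ hρ ↦ ⟨ρ.2, hρ⟩
  set Of : Finset ZetaZeros.riemannZetaNontrivialZeros := hOfin.toFinset with hOf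
  have hmemOf : ∀ ρ : ZetaZeros.riemannZetaNontrivialZeros,
      ρ ∈ Of ↔ B' < |(ρ : ℂ).re - 1 / 2| := fun ρ ↦ by
    rw [hOf, Set.Finite.mem_toFinset]
    rfl
  have hρ₁Of : (⟨ρ₁, hρ₁⟩ : ZetaZeros.riemannZetaNontrivialZeros) ∈ Of :=
    (hmemOf _).2 (lt_of_le_of_lt (le_max_left _ _) hρ₁')
  have hne : Of.Nonempty := ⟨_, hρ₁Of⟩
  -- the top abscissa `B` and the top layer `T`
  set B : ℝ := Of.sup' hne (fun ρ ↦ |(ρ : ℂ).re - 1 / 2|) with hBdef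
  have hleB : ∀ ρ ∈ Of, |(ρ : ℂ).re - 1 / 2| ≤ B := fun ρ hρ ↦
    Finset.le_sup' (fun ρ : ZetaZeros.riemannZetaNontrivialZeros ↦ |(ρ : ℂ).re - 1 / 2|) hρ
  obtain ⟨ρ₀, hρ₀Of, hρ₀B⟩ :=
    Finset.exists_mem_eq_sup' hne (fun ρ : ZetaZeros.riemannZetaNontrivialZeros ↦ |(ρ : ℂ).re - 1 / 2|)
  have hB1 : max B' η < B := lt_of_lt_of_le hρ₁' (hleB _ hρ₁Of)
  have hB'B : B' < B := lt_of_le_of_lt (le_max_left _ _) hB1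
  have hηB : η < B := lt_of_le_of_lt (le_max_right _ _) hB1
  have hBpos : 0 < B := lt_of_le_of_lt hη hηB
  set T : Finset ZetaZeros.riemannZetaNontrivialZeros :=
    Of.filter (fun ρ ↦ |(ρ : ℂ).re - 1 / 2| = B) with hT
  have hρ₀T : ρ₀ ∈ T := Finset.mem_filter.2 ⟨hρ₀Of, hρ₀B.symm⟩
  have hTB : ∀ ρ ∈ T, |(ρ : ℂ).re - 1 / 2| = B := fun ρ hρ ↦ (Finset.mem_filter.1 hρ).2
  -- a uniform abscissa bound `B₃ < B` off the top layer
  obtain ⟨B₃, hB₃B, hB₃0, hB₃⟩ : ∃ B₃ : ℝ, B₃ < B ∧ 0 ≤ B₃ ∧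
      ∀ ρ : ZetaZeros.riemannZetaNontrivialZeros, ρ ∉ T → |(ρ : ℂ).re - 1 / 2| ≤ B₃ := by
    set L : Finset ZetaZeros.riemannZetaNontrivialZeros :=
      Of.filter (fun ρ ↦ ¬ |(ρ : ℂ).re - 1 / 2| = B) with hL
    have hout : ∀ ρ : ZetaZeros.riemannZetaNontrivialZeros, ρ ∉ T → ρ ∉ L →
        |(ρ : ℂ).re - 1 / 2| ≤ max B' 0 := by
      intro ρ hρT hρL
      have hρOf : ρ ∉ Of := fun h' ↦ by
        by_cases hb : |(ρ : ℂ).re - 1 / 2| = B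
        · exact hρT (Finset.mem_filter.2 ⟨h', hb⟩)
        · exact hρL (Finset.mem_filter.2 ⟨h', hb⟩)
      rw [hmemOf] at hρOf
      push Not at hρOf
      exact hρOf.trans (le_max_left _ _)
    rcases L.eq_empty_or_nonempty with hLe | hLne
    · refine ⟨max B' 0, max_lt hB'B hBpos, le_max_right _ _, fun ρ hρ ↦ hout ρ hρ ?_⟩
      rw [hLe]
      exact Finset.notMem_empty _
    · refine ⟨max (max B' 0) (L.sup' hLne (fun ρ ↦ |(ρ : ℂ).re - 1 / 2|)),
        max_lt (max_lt hB'B hBpos) ?_, (le_max_right _ _).trans (le_max_left _ _),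
        fun ρ hρ ↦ ?_⟩
      · refine (Finset.sup'_lt_iff hLne).2 fun ρ hρ ↦ ?_
        have h' := Finset.mem_filter.1 hρ
        exact lt_of_le_of_ne (hleB ρ h'.1) h'.2
      · by_cases hρL : ρ ∈ L
        · exact (Finset.le_sup' (fun ρ : ZetaZeros.riemannZetaNontrivialZeros ↦
            |(ρ : ℂ).re - 1 / 2|) hρL).trans (le_max_right _ _)
        · exact (hout ρ hρ hρL).trans (le_max_left _ _)
  -- coefficients, phases, and the Bohr-mean lemma
  set c : ZetaZeros.riemannZetaNontrivialZeros → ℂ :=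
    fun ρ ↦ (riemannZetaZeroOrder (ρ : ℂ) : ℂ) / ((ρ : ℂ) - 1 / 2) ^ 2 with hc
  set lam : ZetaZeros.riemannZetaNontrivialZeros → ℝ :=
    fun ρ ↦ if 1 / 2 ≤ (ρ : ℂ).re then (ρ : ℂ).im else -(ρ : ℂ).im with hlam
  set u : ZetaZeros.riemannZetaNontrivialZeros → ℂ :=
    fun ρ ↦ Complex.exp (((lam ρ * h : ℝ) : ℂ) * I) with hu
  refine false_of_trigSum_eventually_ge T c u
    (fun ρ _ ↦ by simp only [hu]; exact Complex.norm_exp_ofReal_mul_I _)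
    (fun ρ _ ↦ (re_coeff_neg ρ).le) hρ₀T (re_coeff_neg ρ₀) ?_
  -- the analytic input: `Σ_T Re(c_ρ u_ρ^k) ≥ -E_k` with `E_k → 0`
  set S : ℝ := ∑' ρ : ZetaZeros.riemannZetaNontrivialZeros,
    2 * (riemannZetaZeroOrder (ρ : ℂ) : ℝ) / (ρ : ℂ).im ^ 2 with hSdef
  set CT : ℝ := ∑ ρ ∈ T, ‖c ρ‖ with hCT
  set E : ℕ → ℝ := fun k ↦
    2 * K * (Real.exp (-(B * (k * h))) * Real.exp (η * (k * h))) +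
    2 * S * (Real.exp (-(B * (k * h))) * Real.exp (B₃ * (k * h))) +
    4 * CT * Real.exp (-B * (k * h)) with hE
  have hEt : Tendsto E atTop (𝓝 0) := by
    have e1 := (tendsto_exp_neg_mul_exp_lattice hηB hh).const_mul (2 * K)
    have e2 := (tendsto_exp_neg_mul_exp_lattice hB₃B hh).const_mul (2 * S)
    have e3 := (tendsto_exp_lattice (neg_neg_of_pos hBpos) hh).const_mul (4 * CT)
    have := (e1.add e2).add e3
    simpa [hE] using this
  have hmain : ∀ k : ℕ, -E k ≤ ∑ ρ ∈ T, (c ρ * u ρ ^ k).re := by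
    intro k
    set t : ℝ := k * h with htdef
    have ht : 0 ≤ t := by positivity
    -- the zero series at `t`, split over the finite top layer `T`
    set f : ZetaZeros.riemannZetaNontrivialZeros → ℂ := fun ρ ↦
      (riemannZetaZeroOrder (ρ : ℂ) : ℂ) *
        ((Complex.cosh (((ρ : ℂ) - 1 / 2) * t) - 1) / ((ρ : ℂ) - 1 / 2) ^ 2) with hf
    have hsum : HasSum f (zetaScrew t : ℂ) := Suzuki2023_thm11_series_holds t
    have hsplit : (zetaScrew t : ℂ) =
        ∑ ρ ∈ T, f ρ + ∑' ρ : ↥((T : Set ZetaZeros.riemannZetaNontrivialZeros)ᶜ), f ρ := by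
      rw [← hsum.tsum_eq]
      exact (hsum.summable.sum_add_tsum_compl).symm
    have hΨ : zetaScrew t = ∑ ρ ∈ T, (f ρ).re +
        (∑' ρ : ↥((T : Set ZetaZeros.riemannZetaNontrivialZeros)ᶜ), f ρ).re := by
      have := congrArg Complex.re hsplit
      rwa [Complex.ofReal_re, Complex.add_re, Complex.re_sum] at this
    -- the tail off the top layer: `‖·‖ ≤ e^{B₃ t} S`
    have hg : Summable fun ρ : ZetaZeros.riemannZetaNontrivialZeros ↦
        2 * (riemannZetaZeroOrder (ρ : ℂ) : ℝ) / (ρ : ℂ).im ^ 2 :=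
      ZetaScrewGrowth.summable_two_mul_order_div_im_sq
    have hg0 : ∀ ρ : ZetaZeros.riemannZetaNontrivialZeros,
        0 ≤ 2 * (riemannZetaZeroOrder (ρ : ℂ) : ℝ) / (ρ : ℂ).im ^ 2 := fun ρ ↦ by
      have := FordL33.order_pos ρ
      positivity
    have hS0 : 0 ≤ S := tsum_nonneg hg0
    have htail : ‖∑' ρ : ↥((T : Set ZetaZeros.riemannZetaNontrivialZeros)ᶜ), f ρ‖ ≤
        Real.exp (B₃ * t) * S := by
      have hgs := ((hg.subtype ((T : Set ZetaZeros.riemannZetaNontrivialZeros)ᶜ)).hasSum).mul_left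
        (Real.exp (B₃ * t))
      have h1 := tsum_of_norm_bounded hgs fun ρ ↦ by
        show ‖f ρ‖ ≤ Real.exp (B₃ * t) * _
        have hρT : (ρ : ZetaZeros.riemannZetaNontrivialZeros) ∉ T := fun h' ↦ ρ.2 h'
        refine (norm_term_le (ρ : ZetaZeros.riemannZetaNontrivialZeros) ht).trans ?_
        refine mul_le_mul_of_nonneg_right (Real.exp_le_exp.2 ?_) (hg0 _)
        exact mul_le_mul_of_nonneg_right (hB₃ _ hρT) ht
      refine h1.trans (mul_le_mul_of_nonneg_left ?_ (Real.exp_pos _).le)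
      exact Summable.tsum_subtype_le _ _ hg0 hg
    -- the top layer: `Re f_ρ ≤ (e^{Bt}/2) Re(c_ρ u_ρ^k) + 2‖c_ρ‖`
    have hupow : ∀ ρ : ZetaZeros.riemannZetaNontrivialZeros,
        Complex.exp (((lam ρ * t : ℝ) : ℂ) * I) = u ρ ^ k := fun ρ ↦ by
      simp only [hu, htdef]
      rw [← Complex.exp_nat_mul]
      congr 1
      push_cast
      ring
    have htop : ∑ ρ ∈ T, (f ρ).re ≤
        Real.exp (B * t) / 2 * ∑ ρ ∈ T, (c ρ * u ρ ^ k).re + 2 * CT := by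
      rw [hCT, Finset.mul_sum, Finset.mul_sum, ← Finset.sum_add_distrib]
      refine Finset.sum_le_sum fun ρ hρ ↦ ?_
      have h' := re_term_top ρ ht
      rw [hTB ρ hρ, hupow ρ] at h'
      have h'' := (abs_le.1 h').2
      simp only [hf, hc]
      linarith
    -- assemble
    have hfl : -K * Real.exp (η * t) ≤ zetaScrew t := hK k
    have htail' : -(Real.exp (B₃ * t) * S) ≤
        -(∑' ρ : ↥((T : Set ZetaZeros.riemannZetaNontrivialZeros)ᶜ), f ρ).re := by
      have := (Complex.abs_re_le_norm
        (∑' ρ : ↥((T : Set ZetaZeros.riemannZetaNontrivialZeros)ᶜ), f ρ)).trans htail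
      have := (abs_le.1 this).2
      linarith
    -- `x = e^{Bt}`, `y = e^{-Bt}`, `x y = 1`
    have hxy : Real.exp (B * t) * Real.exp (-(B * t)) = 1 := by
      rw [← Real.exp_add, add_neg_cancel, Real.exp_zero]
    have hy : 0 < Real.exp (-(B * t)) := Real.exp_pos _
    have hkey : -(K * Real.exp (η * t) + Real.exp (B₃ * t) * S + 2 * CT) ≤
        Real.exp (B * t) / 2 * ∑ ρ ∈ T, (c ρ * u ρ ^ k).re := by linarith
    have hkey' := mul_le_mul_of_nonneg_left hkey hy.le
    have hlhs : Real.exp (-(B * t)) * -(K * Real.exp (η * t) + Real.exp (B₃ * t) * S + 2 * CT) =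
        -(K * (Real.exp (-(B * t)) * Real.exp (η * t)) +
          S * (Real.exp (-(B * t)) * Real.exp (B₃ * t)) + 2 * CT * Real.exp (-(B * t))) := by
      ring
    have hrhs : Real.exp (-(B * t)) * (Real.exp (B * t) / 2 * ∑ ρ ∈ T, (c ρ * u ρ ^ k).re) =
        (∑ ρ ∈ T, (c ρ * u ρ ^ k).re) / 2 := by
      have : Real.exp (-(B * t)) * (Real.exp (B * t) / 2 * ∑ ρ ∈ T, (c ρ * u ρ ^ k).re) =
          (Real.exp (B * t) * Real.exp (-(B * t))) * (∑ ρ ∈ T, (c ρ * u ρ ^ k).re) / 2 := by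
        ring
      rw [this, hxy, one_mul]
    rw [hlhs, hrhs] at hkey'
    have hEk : E k = 2 * K * (Real.exp (-(B * t)) * Real.exp (η * t)) +
        2 * S * (Real.exp (-(B * t)) * Real.exp (B₃ * t)) +
        4 * CT * Real.exp (-B * t) := by
      simp only [hE, htdef]
    have hnegB : Real.exp (-B * t) = Real.exp (-(B * t)) := by rw [neg_mul]
    rw [hnegB] at hEk
    rw [hEk]
    linarith
  intro ε hε
  obtain ⟨N₁, hN₁⟩ := eventually_atTop.1 (hEt.eventually (gt_mem_nhds hε))
  exact ⟨N₁, fun k hk ↦ by linarith [hN₁ k hk, hmain k]⟩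

/-! ## 5. Corollaries: the graded lattice dictionary and the splitting at `η = 0` -/

/-- An *eventual* graded lattice floor is a graded lattice floor (enlarge `K` by the finitely many
early values; `η ≥ 0`, `h ≥ 0`). -/
theorem latticeFloor_of_eventually {h η K : ℝ} (hh : 0 ≤ h) (hη : 0 ≤ η) {k₀ : ℕ}
    (hK : ∀ k : ℕ, k₀ ≤ k → -K * Real.exp (η * (k * h)) ≤ zetaScrew (k * h)) :
    ∃ K' : ℝ, ∀ k : ℕ, -K' * Real.exp (η * (k * h)) ≤ zetaScrew (k * h) := by
  refine ⟨max K 0 + ∑ j ∈ Finset.range k₀, |zetaScrew (j * h)|, fun k ↦ ?_⟩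
  have he : 1 ≤ Real.exp (η * (k * h)) := Real.one_le_exp (by positivity)
  have hs0 : 0 ≤ ∑ j ∈ Finset.range k₀, |zetaScrew (j * h)| :=
    Finset.sum_nonneg fun j _ ↦ abs_nonneg _
  rcases le_or_gt k₀ k with hk | hk
  · have h1 := hK k hk
    have h2 : -(max K 0 + ∑ j ∈ Finset.range k₀, |zetaScrew (j * h)|) * Real.exp (η * (k * h)) ≤
        -K * Real.exp (η * (k * h)) := by
      have := le_max_left K 0
      nlinarith [Real.exp_pos (η * (k * h))]
    exact h2.trans h1
  · have h1 : |zetaScrew (k * h)| ≤ ∑ j ∈ Finset.range k₀, |zetaScrew (j * h)| :=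
      Finset.single_le_sum (f := fun j : ℕ ↦ |zetaScrew ((j : ℝ) * h)|) (fun j _ ↦ abs_nonneg _)
        (Finset.mem_range.2 hk)
    have h2 := neg_abs_le (zetaScrew (k * h))
    have h3 := le_max_right K 0
    nlinarith [Real.exp_pos (η * (k * h)), abs_nonneg (zetaScrew (k * h))]

/-- `QuasiRiemannHypothesis (1/2 + η)` gives the graded lattice floor (indeed `|Ψ(t)| ≤ S e^{η|t|}`
for all real `t`, `ScrewGradedFloor.abs_zetaScrew_le_exp_of_strip`). -/
theorem latticeFloor_of_quasiRH {h η : ℝ} (hh : 0 ≤ h) (hη : 0 ≤ η)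
    (hq : QuasiRiemannHypothesis (1 / 2 + η)) :
    ∃ K : ℝ, ∀ k : ℕ, -K * Real.exp (η * (k * h)) ≤ zetaScrew (k * h) := by
  obtain ⟨S, _, hS⟩ :=
    ScrewGradedFloor.abs_zetaScrew_le_exp_of_strip hη (ScrewGradedFloor.strip_of_quasiRH hq)
  refine ⟨S, fun k ↦ ?_⟩
  have ht : 0 ≤ (k : ℝ) * h := by positivity
  have h1 := hS (k * h)
  rw [abs_of_nonneg ht] at h1
  have h2 := (abs_le.1 h1).1
  linarith

/-- `QuasiRiemannHypothesis (1/2 + η)` makes the set of zeros with `|Re ρ - 1/2| > η` empty, hence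
finite. -/
theorem cofiniteStrip_of_quasiRH {η : ℝ} (hq : QuasiRiemannHypothesis (1 / 2 + η)) :
    {ρ : ℂ | ρ ∈ ZetaZeros.riemannZetaNontrivialZeros ∧ η < |ρ.re - 1 / 2|}.Finite := by
  have hstrip := ScrewGradedFloor.strip_of_quasiRH hq
  have hempty : {ρ : ℂ | ρ ∈ ZetaZeros.riemannZetaNontrivialZeros ∧ η < |ρ.re - 1 / 2|} = ∅ := by
    ext ρ
    simp only [Set.mem_setOf_eq, Set.mem_empty_iff_false, iff_false, not_and, not_lt]
    exact fun hρ ↦ hstrip ρ hρ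
  rw [hempty]
  exact Set.finite_empty

/-- **THE GRADED LATTICE DICTIONARY** (`h > 0`, `η ≥ 0`):
`QuasiRiemannHypothesis (1/2 + η)` **iff** (only finitely many zeros have `|Re ρ - 1/2| > η`)
**and** (`Ψ(k h) ≥ -K e^{η k h}` for all `k ∈ ℕ`).  The two conjuncts are the `A ∧ B` of a
splitting of `quasi-RH(1/2 + η)`; at `η = 0` see `foz_and_latticePos_iff_rh`. -/
theorem quasiRH_iff_cofiniteStrip_and_latticeFloor {h η : ℝ} (hh : 0 < h) (hη : 0 ≤ η) :
    QuasiRiemannHypothesis (1 / 2 + η) ↔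
      ({ρ : ℂ | ρ ∈ ZetaZeros.riemannZetaNontrivialZeros ∧ η < |ρ.re - 1 / 2|}.Finite ∧
        ∃ K : ℝ, ∀ k : ℕ, -K * Real.exp (η * (k * h)) ≤ zetaScrew (k * h)) := by
  constructor
  · exact fun hq ↦ ⟨cofiniteStrip_of_quasiRH hq, latticeFloor_of_quasiRH hh.le hη hq⟩
  · rintro ⟨hfin, hfloor⟩
    have hstrip := strip_of_cofiniteStrip_of_latticeFloor hh hη hfin hfloor
    rw [max_self] at hstrip
    exact (ScrewGradedFloor.quasiRH_iff_exp_floor hη).2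
      ((ScrewGradedFloor.strip_iff_exp_floor hη).1 hstrip)

/-- `CofiniteCriticalLine` (finitely many zeros off the line) bounds every cofinite-strip set. -/
theorem cofiniteStrip_of_foz (hfoz : Theses.RuelleBand.CofiniteCriticalLine) {B' : ℝ}
    (hB' : 0 ≤ B') :
    {ρ : ℂ | ρ ∈ ZetaZeros.riemannZetaNontrivialZeros ∧ B' < |ρ.re - 1 / 2|}.Finite := by
  refine Set.Finite.subset hfoz fun ρ hρ ↦ ?_
  obtain ⟨hmem, hB⟩ := hρ
  have hne : ρ.re ≠ 1 / 2 := fun h ↦ by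
    rw [h, sub_self, abs_zero] at hB
    linarith
  exact ⟨zeta_eq_zero hmem, re_pos hmem, re_lt_one hmem, hne⟩

/-- **Under FOZ the whole graded dictionary is sampled by any lattice** (`h > 0`, `η ≥ 0`):
`CofiniteCriticalLine → (QuasiRiemannHypothesis (1/2 + η) ↔ ∃ K, ∀ k, Ψ(k h) ≥ -K e^{η k h})`. -/
theorem foz_imp_quasiRH_iff_latticeFloor {h η : ℝ} (hh : 0 < h) (hη : 0 ≤ η)
    (hfoz : Theses.RuelleBand.CofiniteCriticalLine) :
    QuasiRiemannHypothesis (1 / 2 + η) ↔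
      ∃ K : ℝ, ∀ k : ℕ, -K * Real.exp (η * (k * h)) ≤ zetaScrew (k * h) := by
  rw [quasiRH_iff_cofiniteStrip_and_latticeFloor hh hη]
  exact ⟨fun h' ↦ h'.2, fun h' ↦ ⟨cofiniteStrip_of_foz hfoz hη, h'⟩⟩

/-- **FOZ ∧ (lattice floor) ⇒ RH.**  For every step `h > 0`: if only finitely many non-trivial
zeros lie off the critical line and `Ψ(k h) ≥ -K` for all `k ∈ ℕ`, then the Riemann hypothesis
holds.  (g10's open question V74 «RH ⟺ Ψ(k log q) ≥ 0 ∀ k ?» settled under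
`CofiniteCriticalLine`; unconditionally it stays open.) -/
theorem rh_of_foz_of_latticeFloor {h : ℝ} (hh : 0 < h)
    (hfoz : Theses.RuelleBand.CofiniteCriticalLine)
    (hfloor : ∃ K : ℝ, ∀ k : ℕ, -K ≤ zetaScrew (k * h)) : RiemannHypothesis := by
  have hfloor' : ∃ K : ℝ, ∀ k : ℕ, -K * Real.exp (0 * (k * h)) ≤ zetaScrew (k * h) := by
    obtain ⟨K, hK⟩ := hfloor
    exact ⟨K, fun k ↦ by simpa using hK k⟩
  have hq := (foz_imp_quasiRH_iff_latticeFloor hh le_rfl hfoz).2 hfloor'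
  rw [add_zero] at hq
  exact quasiRiemannHypothesis_one_half_iff_holds.1 hq

/-- RH gives `Ψ ≥ 0` everywhere (Suzuki2023 Thm 1.7, tree `ZetaScrewThm17.zetaScrew_nonneg_of_RH`),
in particular on every lattice. -/
theorem latticePos_of_rh (hRH : RiemannHypothesis) (h : ℝ) : ∀ k : ℕ, 0 ≤ zetaScrew (k * h) :=
  fun k ↦ ZetaScrewThm17.zetaScrew_nonneg_of_RH hRH ((k : ℝ) * h)

/-- Under RH the off-line set in the definition of `CofiniteCriticalLine` is empty (so the
`A`-conjunct of the splitting is RH-implied; stated as set equality, not as the route item).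
(`private`: the statement restates the landed
`Summit.RiemannHypothesis.Cruxes.CofiniteCriticalLine.Negative.offLine_eq_empty_of_riemannHypothesis` of
`Theorems/CofiniteCriticalLine/Negative/Reformulations.lean` — gate `dedup.landed`, typer-applied one-word repair per lead
RULING #121, filing of lane (xii-i); proof bytes unchanged.) -/
private theorem offline_eq_empty_of_rh (hRH : RiemannHypothesis) :
    {s : ℂ | riemannZeta s = 0 ∧ 0 < s.re ∧ s.re < 1 ∧ s.re ≠ 1 / 2} = ∅ := by
  have hq : QuasiRiemannHypothesis (1 / 2 + 0) := by
    rw [add_zero]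
    exact quasiRiemannHypothesis_one_half_iff_holds.2 hRH
  have hstrip := ScrewGradedFloor.strip_of_quasiRH hq
  ext s
  simp only [Set.mem_setOf_eq, Set.mem_empty_iff_false, iff_false, not_and]
  intro hs h0 h1 hne
  have h := hstrip s (mem_of_re_pos hs h0)
  have h' : |s.re - 1 / 2| = 0 := le_antisymm h (abs_nonneg _)
  rw [abs_eq_zero, sub_eq_zero] at h'
  exact hne h'

/-- **THE SPLITTING** (`h > 0` arbitrary):
`CofiniteCriticalLine ∧ (∀ k ∈ ℕ, 0 ≤ Ψ(k h)) ↔ RiemannHypothesis`.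
`A = CofiniteCriticalLine` is RH-implied and not known to imply RH (Bombieri 2000, «J finite»);
`B = lattice positivity` is RH-implied (Thm 1.7) and not known to imply RH (aliasing of infinitely
many off-line ordinates modulo `2π/h`); `A ∧ B ⇒ RH` is this file. -/
theorem foz_and_latticePos_iff_rh {h : ℝ} (hh : 0 < h) :
    (Theses.RuelleBand.CofiniteCriticalLine ∧ ∀ k : ℕ, 0 ≤ zetaScrew (k * h)) ↔
      RiemannHypothesis := by
  constructor
  · rintro ⟨hfoz, hpos⟩
    exact rh_of_foz_of_latticeFloor hh hfoz ⟨0, fun k ↦ by simpa using hpos k⟩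
  · intro hRH
    refine ⟨?_, latticePos_of_rh hRH h⟩
    show {s : ℂ | riemannZeta s = 0 ∧ 0 < s.re ∧ s.re < 1 ∧ s.re ≠ 1 / 2}.Finite
    rw [offline_eq_empty_of_rh hRH]
    exact Set.finite_empty

/-- The same with a bounded-below (rather than non-negative) lattice tail, and only eventually. -/
theorem foz_and_latticeFloor_iff_rh {h : ℝ} (hh : 0 < h) (k₀ : ℕ) :
    (Theses.RuelleBand.CofiniteCriticalLine ∧
        ∃ K : ℝ, ∀ k : ℕ, k₀ ≤ k → -K ≤ zetaScrew (k * h)) ↔ RiemannHypothesis := by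
  constructor
  · rintro ⟨hfoz, K, hK⟩
    have hK' : ∀ k : ℕ, k₀ ≤ k → -K * Real.exp (0 * (k * h)) ≤ zetaScrew (k * h) :=
      fun k hk ↦ by simpa using hK k hk
    obtain ⟨K', hK''⟩ := latticeFloor_of_eventually hh.le le_rfl hK'
    exact rh_of_foz_of_latticeFloor hh hfoz ⟨K', fun k ↦ by simpa using hK'' k⟩
  · intro hRH
    refine ⟨((foz_and_latticePos_iff_rh hh).2 hRH).1, 0, fun k _ ↦ ?_⟩
    simpa using latticePos_of_rh hRH h k

/-- **E1 normal form of the splitting**: for every `h > 0`,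
`RiemannHypothesis ↔ CofiniteCriticalLine ∧ (∀ k, 0 ≤ Ψ(k h))`, i.e. RH splits as
`FIN := CofiniteCriticalLine` (sub-RH, open) and `TAIL := lattice positivity of the screw function`
(RH-implied; `TAIL ⇒ RH` open). -/
theorem rh_iff_foz_and_latticePos {h : ℝ} (hh : 0 < h) :
    RiemannHypothesis ↔
      (Theses.RuelleBand.CofiniteCriticalLine ∧ ∀ k : ℕ, 0 ≤ zetaScrew (k * h)) :=
  (foz_and_latticePos_iff_rh hh).symm

end Summit.RiemannHypothesis.RiemannHypothesis.Theorems.Splittings.ScrewLatticeFoz
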